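import Literature.Analysis.Complex.WeightedArgumentPrinciple
import HarnessLib

/-!
# Littlewood's lemma on a rectangle

Trunk T-ANALYSIS support (complex analysis, `Literature/Analysis/Complex`). Littlewood's lemma
(Littlewood 1924; Titchmarsh, *Theory of Functions*, §3.8; Titchmarsh, *The Theory of the Riemann
Zeta-Function*, §9.9, eq. (9.9.1)) is the integrated form of the argument principle: for `f`
analytic on the closed rectangle `R = [a,b] × [c,d]` and non-zero on `∂R`,

  `2π Σ_{ρ ∈ R°, f(ρ)=0} m(ρ) (Re ρ − a)
      = ∫_c^d log|f(a+iy)| dy − ∫_c^d log|f(b+iy)| dy + ∫_a^b arg f(x+id) dx − ∫_a^b arg f(x+ic) dx`,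

where `arg f` is any continuous branch along the three edges bottom → right → top. It is the
tool by which mean values of `log|f|` on vertical lines bound the zeros of `f` to the right of
the line, weighted by their distance from it (zero-density estimates: Titchmarsh §§9.15–9.19,
9.24; Selberg's and Levinson's methods, Titchmarsh §§10.9–10.29). Neither Mathlib nor this tree had
it (`Literature/NumberTheory/LFunctions/ZeroCountingLevinsonProofs.lean`, "What is NOT here").

## Main results (all proved)

* `Literature.Analysis.Complex.hasDerivAt_log_norm_horizontal`, `…_vertical` — `log ‖f‖` along an
  edge has derivative `Re (f'/f)` (horizontal) resp. `−Im (f'/f)` (vertical);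
  `Literature.Analysis.Complex.re_integral_logDeriv_horizontal`,
  `Literature.Analysis.Complex.im_integral_logDeriv_vertical` — the corresponding exact integrals.
* `Literature.Analysis.Complex.hasDerivAt_primitive_horizontal`, `…_vertical`,
  `Literature.Analysis.Complex.integral_mul_weight_horizontal`, `…_vertical` — the primitive
  `Λ = ∫ f'/f` along an edge (a branch of `log f` along the edge, up to a constant) and the
  integration by parts of `(f'/f)(z) · (z − a)` against it.
* `Literature.Analysis.Complex.littlewood_lemma` — **Littlewood's lemma** in the branch-free form
  `2π Σ m(ρ)(Re ρ − a) = ∫_c^d log‖f(a+iy)‖ − ∫_c^d log‖f(b+iy)‖ + ∫_a^b Im Λ_top − ∫_a^b Im Λ_bot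
   + (b − a) Re ∫_c^d (f'/f)(b+iy) dy`, with `Λ_top(x) = ∫_b^x (f'/f)(u + id) du` (the change of
  `arg f` along the top edge from the corner `b + id` to `x + id`), `Λ_bot` likewise, and
  `Re ∫_c^d (f'/f)(b+iy) dy` the change of `arg f` along the right edge: i.e. (9.9.1) with the
  continuous argument normalised to `0` at the corner `b + ic`.
* `Literature.Analysis.Complex.littlewood_lemma_le` — the inequality form used in practice: if the
  changes of argument along the horizontal edges are bounded by `A` and the one up the right
  edge by `B` in absolute value (Backlund's lemma
  `Literature.Analysis.Complex.abs_im_integral_logDeriv_le_backlund` bounds the horizontal ones by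
  Jensen's formula; on a right edge where `|f − 1| < 1` the principal logarithm bounds the third),
  then `2π Σ m(ρ)(Re ρ − a) ≤ ∫ log‖f(a+iy)‖ − ∫ log‖f(b+iy)‖ + (b − a)(2A + B)`.
* `Literature.Analysis.Complex.order_mul_sub_nonneg`,
  `Literature.Analysis.Complex.sum_order_le_of_lt` — every term of the zero sum is `≥ 0`, so for
  `a < σ < b` the number of zeros (with multiplicity) in `[σ, b) × (c, d)` is at most
  `(σ − a)⁻¹ Σ m(ρ)(Re ρ − a)` (the usual passage from Littlewood's lemma to `N(σ, T)`).

## Proof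

Apply the weighted argument principle `∮_{∂R} (f'/f)(z) (z − a) dz = 2πi Σ m(ρ)(ρ − a)`
(`Literature.Analysis.Complex.integral_boundary_rect_logDeriv_mul` with `g(z) = z − a`) and take
imaginary parts after integrating by parts on each edge against `Λ = ∫ f'/f`: on a horizontal
edge `Re Λ` is `log‖f‖` up to a constant, on a vertical edge `Im Λ` is `−log‖f‖` up to a constant
(`log‖f‖` is differentiable along the edges with the stated derivatives because locally
`log‖f‖ = Re log(f/w₀) + log‖w₀‖` with `f/w₀` near `1`). All the corner terms cancel.

## References

* J. E. Littlewood, *On the zeros of the Riemann zeta-function*, Proc. Cambridge Philos. Soc. 22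
  (1924), 295–318.
* E. C. Titchmarsh, *The Theory of Functions*, 2nd ed., OUP 1939, §3.8.
* E. C. Titchmarsh, *The Theory of the Riemann Zeta-Function*, 2nd ed. revised by
  D. R. Heath-Brown, OUP 1986, §9.9, eq. (9.9.1). [key `Titchmarsh1986`]
-/

noncomputable section

open Complex Set MeasureTheory Filter Topology intervalIntegral

namespace Literature.Analysis.Complex

variable {a b c d : ℝ}

/-! ### `log ‖f‖` along the edges -/

/-- Along a horizontal line, `t ↦ log ‖g(t + yi)‖` has derivative `Re (g'/g)(x + yi)` at `t = x`
if `g` is analytic and non-zero at `x + yi` (locally `log‖g‖ = Re log(g/w₀) + log‖w₀‖`,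
`w₀ = g(x+yi)`). [folklore] -/
theorem hasDerivAt_log_norm_horizontal {g : ℂ → ℂ} {x y : ℝ} (hg : AnalyticAt ℂ g (x + y * I))
    (h0 : g (x + y * I) ≠ 0) :
    HasDerivAt (fun t : ℝ ↦ Real.log ‖g (t + y * I)‖)
      (deriv g (x + y * I) / g (x + y * I)).re x := by
  have hs : g (x + y * I) / g (x + y * I) ∈ slitPlane := by
    rw [div_self h0]; exact one_mem_slitPlane
  have h1 : HasDerivAt (fun w : ℂ ↦ w + y * I) 1 (x : ℂ) := (hasDerivAt_id (x : ℂ)).add_const _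
  have h2 : HasDerivAt (fun w : ℂ ↦ g (w + y * I) / g (x + y * I))
      (deriv g (x + y * I) * 1 / g (x + y * I)) (x : ℂ) :=
    (HasDerivAt.comp (x : ℂ) hg.differentiableAt.hasDerivAt h1).div_const _
  have h3 := h2.clog hs
  have e : deriv g (x + y * I) * 1 / g (x + y * I) / (g (x + y * I) / g (x + y * I)) =
      deriv g (x + y * I) / g (x + y * I) := by
    rw [mul_one, div_div_div_cancel_right₀ h0]
  rw [e] at h3
  have h4 := h3.real_of_complex
  have hc : ContinuousAt (fun t : ℝ ↦ g (t + y * I)) x :=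
    hg.continuousAt.comp (f := fun t : ℝ ↦ (t : ℂ) + y * I) (by fun_prop)
  have hev : (fun t : ℝ ↦ Real.log ‖g (t + y * I)‖) =ᶠ[𝓝 x]
      fun t ↦ (Complex.log (g (t + y * I) / g (x + y * I))).re + Real.log ‖g (x + y * I)‖ := by
    filter_upwards [hc.eventually_ne h0] with t ht
    rw [Complex.log_re, norm_div, Real.log_div (norm_ne_zero_iff.2 ht) (norm_ne_zero_iff.2 h0)]
    ring
  exact (h4.add_const _).congr_of_eventuallyEq hev

/-- Along a vertical line, `t ↦ log ‖g(x + ti)‖` has derivative `−Im (g'/g)(x + yi)` at `t = y`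
if `g` is analytic and non-zero at `x + yi`. [folklore] -/
theorem hasDerivAt_log_norm_vertical {g : ℂ → ℂ} {x y : ℝ} (hg : AnalyticAt ℂ g (x + y * I))
    (h0 : g (x + y * I) ≠ 0) :
    HasDerivAt (fun t : ℝ ↦ Real.log ‖g (x + t * I)‖)
      (-(deriv g (x + y * I) / g (x + y * I)).im) y := by
  have hs : g (x + y * I) / g (x + y * I) ∈ slitPlane := by
    rw [div_self h0]; exact one_mem_slitPlane
  have h1 : HasDerivAt (fun w : ℂ ↦ (x : ℂ) + w * I) (1 * I) (y : ℂ) :=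
    ((hasDerivAt_id (y : ℂ)).mul_const I).const_add _
  have h2 : HasDerivAt (fun w : ℂ ↦ g (x + w * I) / g (x + y * I))
      (deriv g (x + y * I) * (1 * I) / g (x + y * I)) (y : ℂ) :=
    (HasDerivAt.comp (y : ℂ) hg.differentiableAt.hasDerivAt h1).div_const _
  have h3 := h2.clog hs
  have e : deriv g (x + y * I) * (1 * I) / g (x + y * I) / (g (x + y * I) / g (x + y * I)) =
      I * (deriv g (x + y * I) / g (x + y * I)) := by
    rw [one_mul, div_div_div_cancel_right₀ h0]; ring
  rw [e] at h3
  have h4 := h3.real_of_complex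
  rw [I_mul_re] at h4
  have hc : ContinuousAt (fun t : ℝ ↦ g (x + t * I)) y :=
    hg.continuousAt.comp (f := fun t : ℝ ↦ (x : ℂ) + t * I) (by fun_prop)
  have hev : (fun t : ℝ ↦ Real.log ‖g (x + t * I)‖) =ᶠ[𝓝 y]
      fun t ↦ (Complex.log (g (x + t * I) / g (x + y * I))).re + Real.log ‖g (x + y * I)‖ := by
    filter_upwards [hc.eventually_ne h0] with t ht
    rw [Complex.log_re, norm_div, Real.log_div (norm_ne_zero_iff.2 ht) (norm_ne_zero_iff.2 h0)]
    ring
  exact (h4.add_const _).congr_of_eventuallyEq hev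

/-- Continuity of `g'/g` at a point where `g` is analytic and non-zero. [folklore] -/
theorem continuousAt_logDeriv {g : ℂ → ℂ} {z : ℂ} (hg : AnalyticAt ℂ g z) (h0 : g z ≠ 0) :
    ContinuousAt (fun w ↦ deriv g w / g w) z :=
  hg.deriv.continuousAt.div hg.continuousAt h0

/-- **`log ‖f‖` across a horizontal edge.** If `g` is analytic and non-zero at every point of
`[a,b] × {y}` then `Re ∫_a^b (g'/g)(x + yi) dx = log‖g(b+yi)‖ − log‖g(a+yi)‖`. [folklore] -/
theorem re_integral_logDeriv_horizontal {g : ℂ → ℂ} (y : ℝ) (hab : a ≤ b)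
    (hg : ∀ x ∈ Icc a b, AnalyticAt ℂ g (x + y * I)) (h0 : ∀ x ∈ Icc a b, g (x + y * I) ≠ 0) :
    (∫ x : ℝ in a..b, deriv g (x + y * I) / g (x + y * I)).re =
      Real.log ‖g (b + y * I)‖ - Real.log ‖g (a + y * I)‖ := by
  have hφ : ∀ x ∈ Icc a b, ContinuousAt (fun t : ℝ ↦ deriv g (t + y * I) / g (t + y * I)) x :=
    fun x hx ↦ (continuousAt_logDeriv (hg x hx) (h0 x hx)).comp
      (f := fun t : ℝ ↦ (t : ℂ) + y * I) (by fun_prop)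
  have hint : IntervalIntegrable (fun x : ℝ ↦ deriv g (x + y * I) / g (x + y * I)) volume a b :=
    intervalIntegrable_of_continuousAt_horizontal y hab
      (fun x hx ↦ continuousAt_logDeriv (hg x hx) (h0 x hx))
  have hre := intervalIntegral_re hint
  simp only [RCLike.re_to_complex] at hre
  rw [← hre]
  have hderiv : ∀ x ∈ Icc a b, HasDerivAt (fun t : ℝ ↦ Real.log ‖g (t + y * I)‖)
      (deriv g (x + y * I) / g (x + y * I)).re x := fun x hx ↦
    hasDerivAt_log_norm_horizontal (hg x hx) (h0 x hx)
  refine integral_eq_sub_of_hasDerivAt_of_le hab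
    (fun x hx ↦ (hderiv x hx).continuousAt.continuousWithinAt)
    (fun x hx ↦ hderiv x (Ioo_subset_Icc_self hx)) ?_
  refine ContinuousOn.intervalIntegrable fun x hx ↦ ?_
  rw [uIcc_of_le hab] at hx
  exact (continuous_re.continuousAt.comp (hφ x hx)).continuousWithinAt

/-- **`log ‖f‖` across a vertical edge.** If `g` is analytic and non-zero at every point of
`{x} × [c,d]` then `Im ∫_c^d (g'/g)(x + yi) dy = −(log‖g(x+di)‖ − log‖g(x+ci)‖)`. [folklore] -/
theorem im_integral_logDeriv_vertical {g : ℂ → ℂ} (x : ℝ) (hcd : c ≤ d)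
    (hg : ∀ y ∈ Icc c d, AnalyticAt ℂ g (x + y * I)) (h0 : ∀ y ∈ Icc c d, g (x + y * I) ≠ 0) :
    (∫ y : ℝ in c..d, deriv g (x + y * I) / g (x + y * I)).im =
      -(Real.log ‖g (x + d * I)‖ - Real.log ‖g (x + c * I)‖) := by
  have hφ : ∀ y ∈ Icc c d, ContinuousAt (fun t : ℝ ↦ deriv g (x + t * I) / g (x + t * I)) y :=
    fun y hy ↦ (continuousAt_logDeriv (hg y hy) (h0 y hy)).comp
      (f := fun t : ℝ ↦ (x : ℂ) + t * I) (by fun_prop)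
  have hint : IntervalIntegrable (fun y : ℝ ↦ deriv g (x + y * I) / g (x + y * I)) volume c d :=
    intervalIntegrable_of_continuousAt_vertical x hcd
      (fun y hy ↦ continuousAt_logDeriv (hg y hy) (h0 y hy))
  have him := intervalIntegral_im hint
  simp only [RCLike.im_to_complex] at him
  rw [← him]
  have hderiv : ∀ y ∈ Icc c d, HasDerivAt (fun t : ℝ ↦ Real.log ‖g (x + t * I)‖)
      (-(deriv g (x + y * I) / g (x + y * I)).im) y := fun y hy ↦
    hasDerivAt_log_norm_vertical (hg y hy) (h0 y hy)
  have hint' : IntervalIntegrable (fun y : ℝ ↦ -(deriv g (x + y * I) / g (x + y * I)).im)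
      volume c d := by
    refine ContinuousOn.intervalIntegrable fun y hy ↦ ?_
    rw [uIcc_of_le hcd] at hy
    exact (continuous_im.continuousAt.comp (hφ y hy)).neg.continuousWithinAt
  have h := integral_eq_sub_of_hasDerivAt_of_le hcd
    (fun y hy ↦ (hderiv y hy).continuousAt.continuousWithinAt)
    (fun y hy ↦ hderiv y (Ioo_subset_Icc_self hy)) hint'
  rw [intervalIntegral.integral_neg] at h
  linarith

/-! ### Primitives and integration by parts along the edges -/

/-- The primitive `Λ(x) = ∫_{x₀}^x F(u + yi) du` of a function continuous at every point of the
horizontal segment `[a,b] × {y}` (`x₀ ∈ [a,b]`) is continuous on `[a,b]` and has derivative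
`F(x + yi)` at every interior point. [folklore] -/
theorem hasDerivAt_primitive_horizontal {F : ℂ → ℂ} (y : ℝ) (hab : a ≤ b) {x₀ : ℝ}
    (hx₀ : x₀ ∈ Icc a b) (hF : ∀ x ∈ Icc a b, ContinuousAt F (x + y * I)) :
    ContinuousOn (fun x : ℝ ↦ ∫ u : ℝ in x₀..x, F (u + y * I)) (Icc a b) ∧
      ∀ x ∈ Ioo a b,
        HasDerivAt (fun x : ℝ ↦ ∫ u : ℝ in x₀..x, F (u + y * I)) (F (x + y * I)) x := by
  have hφ : ∀ x ∈ Icc a b, ContinuousAt (fun u : ℝ ↦ F (u + y * I)) x := fun x hx ↦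
    (hF x hx).comp (f := fun u : ℝ ↦ (u : ℂ) + y * I) (by fun_prop)
  have hint : IntervalIntegrable (fun u : ℝ ↦ F (u + y * I)) volume a b :=
    intervalIntegrable_of_continuousAt_horizontal y hab hF
  refine ⟨?_, fun x hx ↦ ?_⟩
  · have := continuousOn_primitive_interval' hint (by rwa [uIcc_of_le hab])
    rwa [uIcc_of_le hab] at this
  · have hmeas : StronglyMeasurableAtFilter (fun u : ℝ ↦ F (u + y * I)) (𝓝 x) volume :=
      ContinuousOn.stronglyMeasurableAtFilter isOpen_Ioo
        (fun u hu ↦ (hφ u (Ioo_subset_Icc_self hu)).continuousWithinAt) x hx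
    have hsub : uIcc x₀ x ⊆ uIcc a b := by
      rw [uIcc_of_le hab]
      exact uIcc_subset_Icc hx₀ (Ioo_subset_Icc_self hx)
    exact integral_hasDerivAt_right (hint.mono_set hsub) hmeas (hφ x (Ioo_subset_Icc_self hx))

/-- The primitive `Λ(y) = ∫_{y₀}^y F(x + ui) du` along a vertical segment `{x} × [c,d]`
(`y₀ ∈ [c,d]`): continuous on `[c,d]`, with derivative `F(x + yi)` at interior points.
[folklore] -/
theorem hasDerivAt_primitive_vertical {F : ℂ → ℂ} (x : ℝ) (hcd : c ≤ d) {y₀ : ℝ}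
    (hy₀ : y₀ ∈ Icc c d) (hF : ∀ y ∈ Icc c d, ContinuousAt F (x + y * I)) :
    ContinuousOn (fun y : ℝ ↦ ∫ u : ℝ in y₀..y, F (x + u * I)) (Icc c d) ∧
      ∀ y ∈ Ioo c d,
        HasDerivAt (fun y : ℝ ↦ ∫ u : ℝ in y₀..y, F (x + u * I)) (F (x + y * I)) y := by
  have hφ : ∀ y ∈ Icc c d, ContinuousAt (fun u : ℝ ↦ F (x + u * I)) y := fun y hy ↦
    (hF y hy).comp (f := fun u : ℝ ↦ (x : ℂ) + u * I) (by fun_prop)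
  have hint : IntervalIntegrable (fun u : ℝ ↦ F (x + u * I)) volume c d :=
    intervalIntegrable_of_continuousAt_vertical x hcd hF
  refine ⟨?_, fun y hy ↦ ?_⟩
  · have := continuousOn_primitive_interval' hint (by rwa [uIcc_of_le hcd])
    rwa [uIcc_of_le hcd] at this
  · have hmeas : StronglyMeasurableAtFilter (fun u : ℝ ↦ F (x + u * I)) (𝓝 y) volume :=
      ContinuousOn.stronglyMeasurableAtFilter isOpen_Ioo
        (fun u hu ↦ (hφ u (Ioo_subset_Icc_self hu)).continuousWithinAt) y hy
    have hsub : uIcc y₀ y ⊆ uIcc c d := by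
      rw [uIcc_of_le hcd]
      exact uIcc_subset_Icc hy₀ (Ioo_subset_Icc_self hy)
    exact integral_hasDerivAt_right (hint.mono_set hsub) hmeas (hφ y (Ioo_subset_Icc_self hy))

/-- **Integration by parts on a horizontal edge** against the primitive from the right end point:
for `F` continuous at every point of `[a,b] × {y}` and a real `a'`,
`∫_a^b F(x+yi)(x + yi − a') dx = −(a + yi − a') ∫_b^a F(x+yi) dx − ∫_a^b (∫_b^x F(u+yi) du) dx`.
[folklore] -/
theorem integral_mul_weight_horizontal {F : ℂ → ℂ} (y : ℝ) (hab : a ≤ b) (a' : ℝ)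
    (hF : ∀ x ∈ Icc a b, ContinuousAt F (x + y * I)) :
    ∫ x : ℝ in a..b, F (x + y * I) * ((x : ℂ) + y * I - a') =
      -(((a : ℂ) + y * I - a') * ∫ x : ℝ in b..a, F (x + y * I)) -
        ∫ x : ℝ in a..b, (∫ u : ℝ in b..x, F (u + y * I)) := by
  obtain ⟨hΛc, hΛd⟩ := hasDerivAt_primitive_horizontal y hab ⟨hab, le_rfl⟩ hF
  have hint : IntervalIntegrable (fun u : ℝ ↦ F (u + y * I)) volume a b :=
    intervalIntegrable_of_continuousAt_horizontal y hab hF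
  have hu : ∀ x ∈ Ioo (min a b) (max a b),
      HasDerivAt (fun x : ℝ ↦ (x : ℂ) + y * I - a') 1 x := fun x _ ↦ by
    simpa using (((hasDerivAt_id' x).ofReal_comp).add_const ((y : ℂ) * I)).sub_const (a' : ℂ)
  have hv : ∀ x ∈ Ioo (min a b) (max a b),
      HasDerivAt (fun x : ℝ ↦ ∫ u : ℝ in b..x, F (u + y * I)) (F (x + y * I)) x := by
    intro x hx
    rw [min_eq_left hab, max_eq_right hab] at hx
    exact hΛd x hx
  have hparts := integral_mul_deriv_eq_deriv_mul_of_hasDerivAt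
    (u := fun x : ℝ ↦ (x : ℂ) + y * I - a') (v := fun x : ℝ ↦ ∫ u : ℝ in b..x, F (u + y * I))
    (u' := fun _ ↦ 1) (v' := fun x : ℝ ↦ F (x + y * I))
    (by fun_prop : Continuous fun x : ℝ ↦ (x : ℂ) + y * I - a').continuousOn
    (by rwa [uIcc_of_le hab]) hu hv intervalIntegrable_const hint
  rw [intervalIntegral.integral_same, mul_zero, zero_sub] at hparts
  simp only [one_mul] at hparts
  calc ∫ x : ℝ in a..b, F (x + y * I) * ((x : ℂ) + y * I - a')
      = ∫ x : ℝ in a..b, ((x : ℂ) + y * I - a') * F (x + y * I) := by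
        congr 1; ext x; ring
    _ = _ := by rw [hparts]

/-- **Integration by parts on a vertical edge** against the primitive from the lower end point:
for `F` continuous at every point of `{x} × [c,d]` and a real `a'`,
`∫_c^d F(x+yi)(x + yi − a') dy = (x + di − a') ∫_c^d F(x+yi) dy − i ∫_c^d (∫_c^y F(x+ui) du) dy`.
[folklore] -/
theorem integral_mul_weight_vertical {F : ℂ → ℂ} (x : ℝ) (hcd : c ≤ d) (a' : ℝ)
    (hF : ∀ y ∈ Icc c d, ContinuousAt F (x + y * I)) :
    ∫ y : ℝ in c..d, F (x + y * I) * ((x : ℂ) + y * I - a') =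
      ((x : ℂ) + d * I - a') * (∫ y : ℝ in c..d, F (x + y * I)) -
        I * ∫ y : ℝ in c..d, (∫ u : ℝ in c..y, F (x + u * I)) := by
  obtain ⟨hΛc, hΛd⟩ := hasDerivAt_primitive_vertical x hcd ⟨le_rfl, hcd⟩ hF
  have hint : IntervalIntegrable (fun u : ℝ ↦ F (x + u * I)) volume c d :=
    intervalIntegrable_of_continuousAt_vertical x hcd hF
  have hu : ∀ y ∈ Ioo (min c d) (max c d),
      HasDerivAt (fun y : ℝ ↦ (x : ℂ) + y * I - a') I y := fun y _ ↦ by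
    simpa using ((((hasDerivAt_id' y).ofReal_comp).mul_const I).const_add (x : ℂ)).sub_const
      (a' : ℂ)
  have hv : ∀ y ∈ Ioo (min c d) (max c d),
      HasDerivAt (fun y : ℝ ↦ ∫ u : ℝ in c..y, F (x + u * I)) (F (x + y * I)) y := by
    intro y hy
    rw [min_eq_left hcd, max_eq_right hcd] at hy
    exact hΛd y hy
  have hparts := integral_mul_deriv_eq_deriv_mul_of_hasDerivAt
    (u := fun y : ℝ ↦ (x : ℂ) + y * I - a') (v := fun y : ℝ ↦ ∫ u : ℝ in c..y, F (x + u * I))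
    (u' := fun _ ↦ I) (v' := fun y : ℝ ↦ F (x + y * I))
    (by fun_prop : Continuous fun y : ℝ ↦ (x : ℂ) + y * I - a').continuousOn
    (by rwa [uIcc_of_le hcd]) hu hv intervalIntegrable_const hint
  rw [intervalIntegral.integral_same, mul_zero, sub_zero, intervalIntegral.integral_const_mul]
    at hparts
  calc ∫ y : ℝ in c..d, F (x + y * I) * ((x : ℂ) + y * I - a')
      = ∫ y : ℝ in c..d, ((x : ℂ) + y * I - a') * F (x + y * I) := by
        congr 1; ext y; ring
    _ = _ := by rw [hparts]

/-! ### Littlewood's lemma -/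

/-- Real part of the weighted zero sum: `Re Σ m(ρ)(ρ − a) = Σ m(ρ)(Re ρ − a)`. [folklore] -/
theorem re_finsum_order_mul_sub {f : ℂ → ℂ} {s : Set ℂ} (hs : s.Finite) (a : ℝ) :
    (∑ᶠ ρ ∈ s, ((meromorphicOrderAt f ρ).untop₀ : ℂ) * (ρ - a)).re =
      ∑ᶠ ρ ∈ s, ((meromorphicOrderAt f ρ).untop₀ : ℝ) * (ρ.re - a) := by
  rw [finsum_mem_eq_finite_toFinset_sum _ hs, finsum_mem_eq_finite_toFinset_sum _ hs,
    Complex.re_sum]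
  refine Finset.sum_congr rfl fun ρ _ ↦ ?_
  simp [mul_re]

/-- **Littlewood's lemma** (Titchmarsh, *Theory of Functions* §3.8; *Zeta-function* §9.9
(9.9.1)). Let `f` be analytic at every point of the closed rectangle `R = [a,b] × [c,d]`
(`a < b`, `c < d`) and non-zero on its four edges, and write `F = f'/f`,
`Λ_y(x) = ∫_b^x F(u + yi) du` (`y = c, d`: the branch of `log f` along the bottom/top edge
vanishing at the right corner). Then
`2π Σ_{ρ ∈ R°, f(ρ)=0} m(ρ)(Re ρ − a) = ∫_c^d log‖f(a+yi)‖ dy − ∫_c^d log‖f(b+yi)‖ dy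
  + ∫_a^b Im Λ_d(x) dx − ∫_a^b Im Λ_c(x) dx + (b − a) Re ∫_c^d F(b+yi) dy`,
`m(ρ) = meromorphicOrderAt f ρ` the multiplicity. Here `Im Λ_d(x)`, `Im Λ_c(x)` are the changes
of `arg f` along the top and bottom edges from abscissa `b` to `x`, and `Re ∫_c^d F(b+yi) dy` is
the change of `arg f` up the right edge, so the last three terms are
`∫_a^b arg f(x+di) dx − ∫_a^b arg f(x+ci) dx` for the continuous argument along
bottom → right → top normalised at the corner `b + ci`: this is (9.9.1).
[cite: Titchmarsh1986, §9.9 (9.9.1)] -/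
theorem littlewood_lemma {f : ℂ → ℂ} (hab : a < b) (hcd : c < d)
    (hf : AnalyticOnNhd ℂ f (Icc a b ×ℂ Icc c d))
    (h_bot : ∀ x ∈ Icc a b, f (x + c * I) ≠ 0) (h_top : ∀ x ∈ Icc a b, f (x + d * I) ≠ 0)
    (h_left : ∀ y ∈ Icc c d, f (a + y * I) ≠ 0) (h_right : ∀ y ∈ Icc c d, f (b + y * I) ≠ 0) :
    2 * Real.pi * ∑ᶠ ρ ∈ {ρ : ℂ | f ρ = 0 ∧ ρ ∈ Ioo a b ×ℂ Ioo c d},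
        ((meromorphicOrderAt f ρ).untop₀ : ℝ) * (ρ.re - a) =
      (∫ y : ℝ in c..d, Real.log ‖f (a + y * I)‖) - (∫ y : ℝ in c..d, Real.log ‖f (b + y * I)‖) +
      (∫ x : ℝ in a..b, (∫ u : ℝ in b..x, deriv f (u + d * I) / f (u + d * I)).im) -
      (∫ x : ℝ in a..b, (∫ u : ℝ in b..x, deriv f (u + c * I) / f (u + c * I)).im) +
      (b - a) * (∫ y : ℝ in c..d, deriv f (b + y * I) / f (b + y * I)).re := by
  -- analyticity and non-vanishing at the edge points
  have hA_bot : ∀ x ∈ Icc a b, AnalyticAt ℂ f (x + c * I) := fun x hx ↦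
    hf _ ⟨by simpa using hx, by simpa using hcd.le⟩
  have hA_top : ∀ x ∈ Icc a b, AnalyticAt ℂ f (x + d * I) := fun x hx ↦
    hf _ ⟨by simpa using hx, by simpa using hcd.le⟩
  have hA_left : ∀ y ∈ Icc c d, AnalyticAt ℂ f (a + y * I) := fun y hy ↦
    hf _ ⟨by simpa using hab.le, by simpa using hy⟩
  have hA_right : ∀ y ∈ Icc c d, AnalyticAt ℂ f (b + y * I) := fun y hy ↦
    hf _ ⟨by simpa using hab.le, by simpa using hy⟩
  set F : ℂ → ℂ := fun z ↦ deriv f z / f z with hFdef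
  have hF_bot : ∀ x ∈ Icc a b, ContinuousAt F (x + c * I) := fun x hx ↦
    continuousAt_logDeriv (hA_bot x hx) (h_bot x hx)
  have hF_top : ∀ x ∈ Icc a b, ContinuousAt F (x + d * I) := fun x hx ↦
    continuousAt_logDeriv (hA_top x hx) (h_top x hx)
  have hF_left : ∀ y ∈ Icc c d, ContinuousAt F (a + y * I) := fun y hy ↦
    continuousAt_logDeriv (hA_left y hy) (h_left y hy)
  have hF_right : ∀ y ∈ Icc c d, ContinuousAt F (b + y * I) := fun y hy ↦
    continuousAt_logDeriv (hA_right y hy) (h_right y hy)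
  -- the weighted argument principle with weight `z − a`
  have hg : AnalyticOnNhd ℂ (fun z : ℂ ↦ z - a) (Icc a b ×ℂ Icc c d) := fun z _ ↦
    analyticAt_id.sub analyticAt_const
  have hW := integral_boundary_rect_logDeriv_mul hab hcd hf hg h_bot h_top h_left h_right
  beta_reduce at hW
  -- integration by parts on the four edges
  have hBot := integral_mul_weight_horizontal (F := F) c hab.le a hF_bot
  have hTop := integral_mul_weight_horizontal (F := F) d hab.le a hF_top
  have hRight := integral_mul_weight_vertical (F := F) b hcd.le a hF_right
  have hLeft := integral_mul_weight_vertical (F := F) a hcd.le a hF_left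
  simp only [hFdef] at hBot hTop hRight hLeft
  rw [hBot, hTop, hRight, hLeft] at hW
  -- the real and imaginary parts of the edge integrals
  have hPb : (∫ x : ℝ in b..a, deriv f (x + c * I) / f (x + c * I)).re =
      -(Real.log ‖f (b + c * I)‖ - Real.log ‖f (a + c * I)‖) := by
    rw [intervalIntegral.integral_symm, neg_re, re_integral_logDeriv_horizontal c hab.le hA_bot h_bot]
  have hPt : (∫ x : ℝ in b..a, deriv f (x + d * I) / f (x + d * I)).re =
      -(Real.log ‖f (b + d * I)‖ - Real.log ‖f (a + d * I)‖) := by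
    rw [intervalIntegral.integral_symm, neg_re, re_integral_logDeriv_horizontal d hab.le hA_top h_top]
  have hR : (∫ y : ℝ in c..d, deriv f (b + y * I) / f (b + y * I)).im =
      -(Real.log ‖f (b + d * I)‖ - Real.log ‖f (b + c * I)‖) :=
    im_integral_logDeriv_vertical b hcd.le hA_right h_right
  have hL : (∫ y : ℝ in c..d, deriv f (a + y * I) / f (a + y * I)).im =
      -(Real.log ‖f (a + d * I)‖ - Real.log ‖f (a + c * I)‖) :=
    im_integral_logDeriv_vertical a hcd.le hA_left h_left
  -- the double integrals on the vertical edges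
  have hQv : ∀ x₀ : ℝ, (∀ y ∈ Icc c d, AnalyticAt ℂ f (x₀ + y * I)) →
      (∀ y ∈ Icc c d, f (x₀ + y * I) ≠ 0) →
      (∫ y : ℝ in c..d, (∫ u : ℝ in c..y, deriv f (x₀ + u * I) / f (x₀ + u * I))).im =
        -(∫ y : ℝ in c..d, Real.log ‖f (x₀ + y * I)‖) + (d - c) * Real.log ‖f (x₀ + c * I)‖ := by
    intro x₀ hA h0
    obtain ⟨hΛc, -⟩ := hasDerivAt_primitive_vertical (F := F) x₀ hcd.le ⟨le_rfl, hcd.le⟩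
      (fun y hy ↦ continuousAt_logDeriv (hA y hy) (h0 y hy))
    simp only [hFdef] at hΛc
    have hint : IntervalIntegrable
        (fun y : ℝ ↦ ∫ u : ℝ in c..y, deriv f (x₀ + u * I) / f (x₀ + u * I)) volume c d :=
      (hΛc.mono (by rw [uIcc_of_le hcd.le])).intervalIntegrable
    have him := intervalIntegral_im hint
    simp only [RCLike.im_to_complex] at him
    rw [← him]
    have hcongr : EqOn (fun y : ℝ ↦ (∫ u : ℝ in c..y, deriv f (x₀ + u * I) / f (x₀ + u * I)).im)
        (fun y : ℝ ↦ -Real.log ‖f (x₀ + y * I)‖ + Real.log ‖f (x₀ + c * I)‖) (uIcc c d) := by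
      intro y hy
      rw [uIcc_of_le hcd.le] at hy
      simp only
      rw [im_integral_logDeriv_vertical x₀ hy.1 (fun u hu ↦ hA u ⟨hu.1, hu.2.trans hy.2⟩)
        (fun u hu ↦ h0 u ⟨hu.1, hu.2.trans hy.2⟩)]
      ring
    rw [intervalIntegral.integral_congr hcongr]
    have hlog : IntervalIntegrable (fun y : ℝ ↦ Real.log ‖f (x₀ + y * I)‖) volume c d := by
      refine ContinuousOn.intervalIntegrable fun y hy ↦ ?_
      rw [uIcc_of_le hcd.le] at hy
      have h1 : ContinuousAt (fun y : ℝ ↦ f (x₀ + y * I)) y :=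
        (hA y hy).continuousAt.comp (f := fun t : ℝ ↦ (x₀ : ℂ) + t * I) (by fun_prop)
      exact ((h1.norm).log (norm_ne_zero_iff.2 (h0 y hy))).continuousWithinAt
    have hlog' : IntervalIntegrable (fun y : ℝ ↦ -Real.log ‖f (x₀ + y * I)‖) volume c d :=
      hlog.neg
    rw [intervalIntegral.integral_add hlog' intervalIntegrable_const,
      intervalIntegral.integral_neg, intervalIntegral.integral_const, smul_eq_mul]
  have hQr := hQv b hA_right h_right
  have hQl := hQv a hA_left h_left
  -- the double integrals on the horizontal edges: only their imaginary parts enter, as such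
  have hQh : ∀ y₀ : ℝ, (∀ x ∈ Icc a b, AnalyticAt ℂ f (x + y₀ * I)) →
      (∀ x ∈ Icc a b, f (x + y₀ * I) ≠ 0) →
      (∫ x : ℝ in a..b, (∫ u : ℝ in b..x, deriv f (u + y₀ * I) / f (u + y₀ * I))).im =
        ∫ x : ℝ in a..b, (∫ u : ℝ in b..x, deriv f (u + y₀ * I) / f (u + y₀ * I)).im := by
    intro y₀ hA h0
    obtain ⟨hΛc, -⟩ := hasDerivAt_primitive_horizontal (F := F) y₀ hab.le ⟨hab.le, le_rfl⟩
      (fun x hx ↦ continuousAt_logDeriv (hA x hx) (h0 x hx))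
    simp only [hFdef] at hΛc
    have hint : IntervalIntegrable
        (fun x : ℝ ↦ ∫ u : ℝ in b..x, deriv f (u + y₀ * I) / f (u + y₀ * I)) volume a b :=
      (hΛc.mono (by rw [uIcc_of_le hab.le])).intervalIntegrable
    have him := intervalIntegral_im hint
    simp only [RCLike.im_to_complex] at him
    rw [← him]
  have hQb := hQh c hA_bot h_bot
  have hQt := hQh d hA_top h_top
  -- the zero sum is real
  have hcorner : ((a : ℂ) + c * I) ∈ Icc a b ×ℂ Icc c d :=
    ⟨by simpa using hab.le, by simpa using hcd.le⟩
  have hfin := finite_zeros_reProdIm hab.le hcd.le hf hcorner (h_bot a ⟨le_rfl, hab.le⟩)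
  have hZ := re_finsum_order_mul_sub (f := f) hfin a
  -- take imaginary parts
  have hIm := congrArg Complex.im hW
  simp only [sub_im, add_im, neg_im, mul_im, mul_re, I_re, I_im, ofReal_re, ofReal_im,
    sub_re, add_re, zero_mul, mul_zero, sub_zero, zero_sub, add_zero, zero_add,
    mul_one, one_mul, re_ofNat, im_ofNat] at hIm
  rw [hPb, hPt, hR, hL, hQr, hQl, hQb, hQt, hZ] at hIm
  linear_combination -hIm

/-- **Littlewood's lemma, inequality form.** In the setting of `littlewood_lemma`, if the change of
`arg f` along the top and bottom edges (from the right corner to any point) is at most `A` in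
absolute value and the change of `arg f` up the right edge is at most `B` in absolute value, then
`2π Σ m(ρ)(Re ρ − a) ≤ ∫_c^d log‖f(a+yi)‖ dy − ∫_c^d log‖f(b+yi)‖ dy + (b − a)(2A + B)`.
(Backlund's lemma `abs_im_integral_logDeriv_le_backlund` supplies `A` from Jensen's formula; if
`Re f > 0` on the right edge, `B = π` by `integral_logDeriv_vertical`.) This is the form in which
Littlewood's lemma feeds zero-density estimates (Titchmarsh §9.15–9.19, §9.24).
[cite: Titchmarsh1986, §9.9 (9.9.1)] -/
theorem littlewood_lemma_le {f : ℂ → ℂ} (hab : a < b) (hcd : c < d)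
    (hf : AnalyticOnNhd ℂ f (Icc a b ×ℂ Icc c d))
    (h_bot : ∀ x ∈ Icc a b, f (x + c * I) ≠ 0) (h_top : ∀ x ∈ Icc a b, f (x + d * I) ≠ 0)
    (h_left : ∀ y ∈ Icc c d, f (a + y * I) ≠ 0) (h_right : ∀ y ∈ Icc c d, f (b + y * I) ≠ 0)
    {A B : ℝ}
    (hA_top : ∀ x ∈ Icc a b, |(∫ u : ℝ in b..x, deriv f (u + d * I) / f (u + d * I)).im| ≤ A)
    (hA_bot : ∀ x ∈ Icc a b, |(∫ u : ℝ in b..x, deriv f (u + c * I) / f (u + c * I)).im| ≤ A)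
    (hB : |(∫ y : ℝ in c..d, deriv f (b + y * I) / f (b + y * I)).re| ≤ B) :
    2 * Real.pi * ∑ᶠ ρ ∈ {ρ : ℂ | f ρ = 0 ∧ ρ ∈ Ioo a b ×ℂ Ioo c d},
        ((meromorphicOrderAt f ρ).untop₀ : ℝ) * (ρ.re - a) ≤
      (∫ y : ℝ in c..d, Real.log ‖f (a + y * I)‖) - (∫ y : ℝ in c..d, Real.log ‖f (b + y * I)‖) +
        (b - a) * (2 * A + B) := by
  rw [littlewood_lemma hab hcd hf h_bot h_top h_left h_right]
  have hba : 0 ≤ b - a := by linarith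
  have h1 : |∫ x : ℝ in a..b, (∫ u : ℝ in b..x, deriv f (u + d * I) / f (u + d * I)).im| ≤
      A * (b - a) := by
    have := intervalIntegral.norm_integral_le_of_norm_le_const (a := a) (b := b) (C := A)
      (f := fun x : ℝ ↦ (∫ u : ℝ in b..x, deriv f (u + d * I) / f (u + d * I)).im)
      (fun x hx ↦ by
        rw [uIoc_of_le hab.le] at hx
        rw [Real.norm_eq_abs]; exact hA_top x (Ioc_subset_Icc_self hx))
    rwa [Real.norm_eq_abs, abs_of_nonneg hba] at this
  have h2 : |∫ x : ℝ in a..b, (∫ u : ℝ in b..x, deriv f (u + c * I) / f (u + c * I)).im| ≤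
      A * (b - a) := by
    have := intervalIntegral.norm_integral_le_of_norm_le_const (a := a) (b := b) (C := A)
      (f := fun x : ℝ ↦ (∫ u : ℝ in b..x, deriv f (u + c * I) / f (u + c * I)).im)
      (fun x hx ↦ by
        rw [uIoc_of_le hab.le] at hx
        rw [Real.norm_eq_abs]; exact hA_bot x (Ioc_subset_Icc_self hx))
    rwa [Real.norm_eq_abs, abs_of_nonneg hba] at this
  have h3 : (b - a) * (∫ y : ℝ in c..d, deriv f (b + y * I) / f (b + y * I)).re ≤ (b - a) * B :=
    mul_le_mul_of_nonneg_left ((le_abs_self _).trans hB) hba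
  have h1' := (le_abs_self _).trans h1
  have h2' := (neg_le_abs _).trans h2
  nlinarith

/-- For an analytic `f`, every term of Littlewood's zero sum over the open rectangle is
non-negative: `m(ρ) ≥ 0` and `Re ρ > a`. [folklore] -/
theorem order_mul_sub_nonneg {f : ℂ → ℂ} (hf : AnalyticOnNhd ℂ f (Icc a b ×ℂ Icc c d)) {ρ : ℂ}
    (hρ : ρ ∈ {ρ : ℂ | f ρ = 0 ∧ ρ ∈ Ioo a b ×ℂ Ioo c d}) :
    0 ≤ ((meromorphicOrderAt f ρ).untop₀ : ℝ) * (ρ.re - a) := by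
  have hρK : ρ ∈ Icc a b ×ℂ Icc c d := ⟨Ioo_subset_Icc_self hρ.2.1, Ioo_subset_Icc_self hρ.2.2⟩
  refine mul_nonneg ?_ (by linarith [hρ.2.1.1])
  rw [(hf ρ hρK).meromorphicOrderAt_eq]
  cases analyticOrderAt f ρ with
  | top => simp
  | coe n => simp

/-- **Zero counting from Littlewood's lemma.** For `a < σ < b`, the number of zeros of `f`
(with multiplicity) in `[σ, b) × (c, d)` is at most `(σ − a)⁻¹ Σ_{ρ ∈ R°} m(ρ)(Re ρ − a)`.
[cite: Titchmarsh1986, §9.9] -/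
theorem sum_order_le_of_lt {f : ℂ → ℂ} (hab : a ≤ b) (hcd : c ≤ d)
    (hf : AnalyticOnNhd ℂ f (Icc a b ×ℂ Icc c d)) {w : ℂ} (hw : w ∈ Icc a b ×ℂ Icc c d)
    (hfw : f w ≠ 0) {σ : ℝ} (haσ : a < σ) :
    (σ - a) * ∑ᶠ ρ ∈ {ρ : ℂ | f ρ = 0 ∧ ρ ∈ Ico σ b ×ℂ Ioo c d},
        ((meromorphicOrderAt f ρ).untop₀ : ℝ) ≤
      ∑ᶠ ρ ∈ {ρ : ℂ | f ρ = 0 ∧ ρ ∈ Ioo a b ×ℂ Ioo c d},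
        ((meromorphicOrderAt f ρ).untop₀ : ℝ) * (ρ.re - a) := by
  have hfin := finite_zeros_reProdIm hab hcd hf hw hfw
  have hsub : {ρ : ℂ | f ρ = 0 ∧ ρ ∈ Ico σ b ×ℂ Ioo c d} ⊆
      {ρ : ℂ | f ρ = 0 ∧ ρ ∈ Ioo a b ×ℂ Ioo c d} := fun ρ hρ ↦
    ⟨hρ.1, ⟨haσ.trans_le hρ.2.1.1, hρ.2.1.2⟩, hρ.2.2⟩
  have hfin' := hfin.subset hsub
  rw [finsum_mem_eq_finite_toFinset_sum _ hfin, finsum_mem_eq_finite_toFinset_sum _ hfin',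
    Finset.mul_sum]
  have hsubF : hfin'.toFinset ⊆ hfin.toFinset := by
    intro ρ hρ
    rw [Set.Finite.mem_toFinset] at hρ ⊢
    exact hsub hρ
  calc ∑ ρ ∈ hfin'.toFinset, (σ - a) * ((meromorphicOrderAt f ρ).untop₀ : ℝ)
      ≤ ∑ ρ ∈ hfin'.toFinset, ((meromorphicOrderAt f ρ).untop₀ : ℝ) * (ρ.re - a) := by
        refine Finset.sum_le_sum fun ρ hρ ↦ ?_
        rw [Set.Finite.mem_toFinset] at hρ
        have hρK : ρ ∈ Icc a b ×ℂ Icc c d :=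
          ⟨⟨(haσ.trans_le hρ.2.1.1).le, hρ.2.1.2.le⟩, Ioo_subset_Icc_self hρ.2.2⟩
        have hm : 0 ≤ ((meromorphicOrderAt f ρ).untop₀ : ℝ) := by
          rw [(hf ρ hρK).meromorphicOrderAt_eq]
          cases analyticOrderAt f ρ with
          | top => simp
          | coe n => simp
        rw [mul_comm]
        exact mul_le_mul_of_nonneg_left (by linarith [hρ.2.1.1]) hm
    _ ≤ ∑ ρ ∈ hfin.toFinset, ((meromorphicOrderAt f ρ).untop₀ : ℝ) * (ρ.re - a) :=
        Finset.sum_le_sum_of_subset_of_nonneg hsubF fun ρ hρ _ ↦ by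
          rw [Set.Finite.mem_toFinset] at hρ
          exact order_mul_sub_nonneg hf hρ

end Literature.Analysis.Complex

end
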